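import Mathlib.Analysis.Complex.Basic
import Mathlib.Data.Matrix.Basis
import Mathlib.LinearAlgebra.Matrix.ConjTranspose
import Mathlib.Tactic.Module
import HarnessLib

/-!
# Two explicit unitary rotations of an `𝔰𝔲(2)`-block inside `M_N(ℂ)` carrying the Pauli vector `y₁ = i(E_ii − E_jj)` to `y₃ = i(E_ij + E_ji)` and to `y₂ = E_ij − E_ji`
# (the adjoint action of `U(2)` on the unit sphere of `𝔰𝔲(2)` is transitive on the Pauli frame; Hall §1.2, Horn–Johnson §2.1)

Topic `LinearAlgebra/Matrix`; namespace `Literature.LinearAlgebra.Matrix.SU2Block`.  THEOREMS ONLY (no `def`, no instance, no notation, no axiom, no named fact, no `sorry`).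
Companion of `UnitaryBlockPauliFrameTrace` (the invariance of the frame sum); written for cell `pub/hodgecm-mathlib` (ENGINE T1, crux H413 = `stmt-HodgeConjecture-24833`),
ROAD A (A2″) part 2b: the consumer `NumberTheory/Rogawski1990/ArchCompactWallTransversalTrace` needs, inside the compact centraliser `Z(t₀) ≅ U(2) × …` of a compact-wall
point, three group elements `1, m₂, m₃` with `Ad(m_a) y₁ =` the three Pauli vectors, so that averaging the transversal Hessian over them produces its TRACE.  Author A-p14 (g28).

THE MATRICES (`i ≠ j`, `E_kl = Matrix.single k l 1`, `c` a scalar; at `c = 1∕√2` they are unitary):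
`R(c) = 1 − E_ii − E_jj + c•(E_ii + E_jj + E_ji − E_ij)` (block `c·[[1,−1],[1,1]]`, the rotation by `π∕4`), `S(c) = 1 − E_ii − E_jj + c•(E_ii − E_ij) + (ic)•(E_ji + E_jj)` (block `diag(1,i)·R`).
* §1 plumbing: `(E_ab(c))ᴴ`, `diag d · E_ab`, `E_ab · diag d`.
* §2 `R(c)ᴴ (diag e) R(c) = diag e` and `R Rᴴ = 1` for `e_i = e_j`, `c` real, `2c² = 1`; `R(c)` commutes with diagonal matrices constant on the block; the same for `S(c)`.
* §3 the INTERTWINING identities (linear in `c`, no normalisation needed): `R(c) y₁ = y₃ R(c)`, `S(c) y₁ = y₂ S(c)`.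
HONEST LABEL: elementary matrix algebra; pays nothing by itself (HC_CM is proved only modulo the printed citations until rung 0 closes).

## References
* [Hall2015] B. C. Hall, *Lie Groups, Lie Algebras, and Representations*, 2nd ed., GTM 222 (2015), §1.2 (`SU(2)`, the Pauli basis; `Ad : SU(2) → SO(3)` is onto).
* [HornJohnson2013] R. A. Horn, C. R. Johnson, *Matrix Analysis*, 2nd ed. (2013), §0.2, §0.9 (matrix units, diagonal matrices), §2.1 (unitary matrices).
-/

set_option autoImplicit false

noncomputable section

open Finset Matrix Complex
open scoped ComplexConjugate

namespace Literature.LinearAlgebra.Matrix.SU2Block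

variable {N : ℕ}

/-! ## §1 Plumbing: matrix units against conjugate transpose and diagonal matrices -/

/-- `(E_ab(c))ᴴ = E_ba(c̄)`. [cite: HornJohnson2013, §0.2] -/
theorem conjTranspose_single (a b : Fin N) (c : ℂ) : (Matrix.single a b c)ᴴ = Matrix.single b a (conj c) := by
  ext k l
  simp only [Matrix.conjTranspose_apply, Matrix.single, Matrix.of_apply, Complex.star_def]
  by_cases h : a = l ∧ b = k
  · rw [if_pos h, if_pos ⟨h.2, h.1⟩]
  · rw [if_neg h, if_neg (fun h' => h ⟨h'.2, h'.1⟩), map_zero]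

/-- `diag d · E_ab(c) = d_a • E_ab(c)`. [cite: HornJohnson2013, §0.9] -/
theorem diagonal_mul_single' (d : Fin N → ℂ) (a b : Fin N) (c : ℂ) : Matrix.diagonal d * Matrix.single a b c = d a • Matrix.single a b c := by
  ext k l
  simp only [Matrix.diagonal_mul, Matrix.smul_apply, Matrix.single, Matrix.of_apply, smul_eq_mul]
  by_cases h : a = k ∧ b = l
  · rw [if_pos h, h.1]
  · rw [if_neg h, mul_zero, mul_zero]

/-- `E_ab(c) · diag d = d_b • E_ab(c)`. [cite: HornJohnson2013, §0.9] -/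
theorem single_mul_diagonal' (d : Fin N → ℂ) (a b : Fin N) (c : ℂ) : Matrix.single a b c * Matrix.diagonal d = d b • Matrix.single a b c := by
  ext k l
  simp only [Matrix.mul_diagonal, Matrix.smul_apply, Matrix.single, Matrix.of_apply, smul_eq_mul]
  by_cases h : a = k ∧ b = l
  · rw [if_pos h, h.2, mul_comm]
  · rw [if_neg h, zero_mul, mul_zero]

/-! ## §2 The two rotations are `H`-unitary, unitary, and centralise the block-constant diagonals -/

/-- **`R(c)` IS `H`-UNITARY** for `H = diag e` with `e_i = e_j` when `c` is real with `2c² = 1`: `R(c)ᴴ (diag e) R(c) = diag e`. [cite: HornJohnson2013, §2.1] -/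
theorem conjTranspose_rotation_mul_diagonal_mul {i j : Fin N} (hij : i ≠ j) {e : Fin N → ℂ} (heij : e i = e j) (c : ℝ) (hc : (c : ℂ) * c = 1 / 2) :
    ((1 : Matrix (Fin N) (Fin N) ℂ) - Matrix.single i i 1 - Matrix.single j j 1 +
        (c : ℂ) • (Matrix.single i i 1 + Matrix.single j j 1 + Matrix.single j i 1 - Matrix.single i j 1))ᴴ * Matrix.diagonal e *
      ((1 : Matrix (Fin N) (Fin N) ℂ) - Matrix.single i i 1 - Matrix.single j j 1 +
        (c : ℂ) • (Matrix.single i i 1 + Matrix.single j j 1 + Matrix.single j i 1 - Matrix.single i j 1)) = Matrix.diagonal e := by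
  simp only [Matrix.conjTranspose_add, Matrix.conjTranspose_sub, Matrix.conjTranspose_one, Matrix.conjTranspose_smul, conjTranspose_single, map_one,
    Complex.star_def, Complex.conj_ofReal, Matrix.mul_add, Matrix.add_mul, Matrix.mul_sub, Matrix.sub_mul, Matrix.smul_mul, Matrix.mul_smul, Matrix.one_mul,
    smul_add, smul_sub, diagonal_mul_single', single_mul_diagonal', Matrix.single_mul_single_same, Matrix.single_mul_single_of_ne, hij, hij.symm,
    ne_eq, not_false_eq_true, mul_one, smul_zero, sub_zero, add_zero, zero_add, smul_smul, heij]
  match_scalars <;> first | rfl | ring_nf <;> (try rw [show (c : ℂ) ^ 2 = 1 / 2 by rw [sq, hc]]) <;> ring_nf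

/-- **`R(c) R(c)ᴴ = 1`** (`c` real, `2c² = 1`). [cite: HornJohnson2013, §2.1] -/
theorem rotation_mul_conjTranspose {i j : Fin N} (hij : i ≠ j) (c : ℝ) (hc : (c : ℂ) * c = 1 / 2) :
    ((1 : Matrix (Fin N) (Fin N) ℂ) - Matrix.single i i 1 - Matrix.single j j 1 +
        (c : ℂ) • (Matrix.single i i 1 + Matrix.single j j 1 + Matrix.single j i 1 - Matrix.single i j 1)) *
      ((1 : Matrix (Fin N) (Fin N) ℂ) - Matrix.single i i 1 - Matrix.single j j 1 +
        (c : ℂ) • (Matrix.single i i 1 + Matrix.single j j 1 + Matrix.single j i 1 - Matrix.single i j 1))ᴴ = 1 := by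
  simp only [Matrix.conjTranspose_add, Matrix.conjTranspose_sub, Matrix.conjTranspose_one, Matrix.conjTranspose_smul, conjTranspose_single, map_one,
    Complex.star_def, Complex.conj_ofReal, Matrix.mul_add, Matrix.add_mul, Matrix.mul_sub, Matrix.sub_mul, Matrix.smul_mul, Matrix.mul_smul, Matrix.one_mul,
    smul_add, smul_sub, Matrix.single_mul_single_same, Matrix.single_mul_single_of_ne, hij, hij.symm,
    ne_eq, not_false_eq_true, mul_one, smul_zero, sub_zero, add_zero, zero_add, smul_smul]
  match_scalars <;> first | rfl | ring_nf <;> (try rw [show (c : ℂ) ^ 2 = 1 / 2 by rw [sq, hc]]) <;> ring_nf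

/-- `R(c)` commutes with every diagonal matrix constant on the block (`d_i = d_j`): it lies in the centraliser of a compact-wall point. [cite: HornJohnson2013, §0.9] -/
theorem rotation_mul_diagonal {i j : Fin N} {d : Fin N → ℂ} (hdij : d i = d j) (c : ℂ) :
    ((1 : Matrix (Fin N) (Fin N) ℂ) - Matrix.single i i 1 - Matrix.single j j 1 +
        c • (Matrix.single i i 1 + Matrix.single j j 1 + Matrix.single j i 1 - Matrix.single i j 1)) * Matrix.diagonal d =
      Matrix.diagonal d * ((1 : Matrix (Fin N) (Fin N) ℂ) - Matrix.single i i 1 - Matrix.single j j 1 +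
        c • (Matrix.single i i 1 + Matrix.single j j 1 + Matrix.single j i 1 - Matrix.single i j 1)) := by
  simp only [Matrix.mul_add, Matrix.add_mul, Matrix.mul_sub, Matrix.sub_mul, Matrix.smul_mul, Matrix.mul_smul, Matrix.one_mul, Matrix.mul_one,
    diagonal_mul_single', single_mul_diagonal', hdij]

/-- **`S(c)` IS `H`-UNITARY** for `H = diag e` with `e_i = e_j` when `c` is real with `2c² = 1`: `S(c)ᴴ (diag e) S(c) = diag e`. [cite: HornJohnson2013, §2.1] -/
theorem conjTranspose_rotation'_mul_diagonal_mul {i j : Fin N} (hij : i ≠ j) {e : Fin N → ℂ} (heij : e i = e j) (c : ℝ) (hc : (c : ℂ) * c = 1 / 2) :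
    ((1 : Matrix (Fin N) (Fin N) ℂ) - Matrix.single i i 1 - Matrix.single j j 1 +
        (c : ℂ) • (Matrix.single i i 1 - Matrix.single i j 1) + (I * c) • (Matrix.single j i 1 + Matrix.single j j 1))ᴴ * Matrix.diagonal e *
      ((1 : Matrix (Fin N) (Fin N) ℂ) - Matrix.single i i 1 - Matrix.single j j 1 +
        (c : ℂ) • (Matrix.single i i 1 - Matrix.single i j 1) + (I * c) • (Matrix.single j i 1 + Matrix.single j j 1)) = Matrix.diagonal e := by
  have hI : I * I = -1 := Complex.I_mul_I
  simp only [Matrix.conjTranspose_add, Matrix.conjTranspose_sub, Matrix.conjTranspose_one, Matrix.conjTranspose_smul, conjTranspose_single, map_one, map_mul,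
    Complex.star_def, Complex.conj_ofReal, Complex.conj_I, Matrix.mul_add, Matrix.add_mul, Matrix.mul_sub, Matrix.sub_mul, Matrix.smul_mul, Matrix.mul_smul, Matrix.one_mul,
    smul_add, smul_sub, diagonal_mul_single', single_mul_diagonal', Matrix.single_mul_single_same, Matrix.single_mul_single_of_ne, hij, hij.symm,
    ne_eq, not_false_eq_true, mul_one, smul_zero, sub_zero, add_zero, smul_smul, heij]
  match_scalars <;> first | rfl | (ring_nf; (try simp only [Complex.I_sq, show (c : ℂ) ^ 2 = 1 / 2 by rw [sq, hc]]); (try ring_nf))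

/-- **`S(c) S(c)ᴴ = 1`** (`c` real, `2c² = 1`). [cite: HornJohnson2013, §2.1] -/
theorem rotation'_mul_conjTranspose {i j : Fin N} (hij : i ≠ j) (c : ℝ) (hc : (c : ℂ) * c = 1 / 2) :
    ((1 : Matrix (Fin N) (Fin N) ℂ) - Matrix.single i i 1 - Matrix.single j j 1 +
        (c : ℂ) • (Matrix.single i i 1 - Matrix.single i j 1) + (I * c) • (Matrix.single j i 1 + Matrix.single j j 1)) *
      ((1 : Matrix (Fin N) (Fin N) ℂ) - Matrix.single i i 1 - Matrix.single j j 1 +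
        (c : ℂ) • (Matrix.single i i 1 - Matrix.single i j 1) + (I * c) • (Matrix.single j i 1 + Matrix.single j j 1))ᴴ = 1 := by
  simp only [Matrix.conjTranspose_add, Matrix.conjTranspose_sub, Matrix.conjTranspose_one, Matrix.conjTranspose_smul, conjTranspose_single, map_one, map_mul,
    Complex.star_def, Complex.conj_ofReal, Complex.conj_I, Matrix.mul_add, Matrix.add_mul, Matrix.mul_sub, Matrix.sub_mul, Matrix.smul_mul, Matrix.mul_smul, Matrix.one_mul,
    smul_add, smul_sub, Matrix.single_mul_single_same, Matrix.single_mul_single_of_ne, hij, hij.symm,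
    ne_eq, not_false_eq_true, mul_one, smul_zero, sub_zero, add_zero, zero_add, smul_smul]
  match_scalars <;> first | rfl | (ring_nf; (try simp only [Complex.I_sq, show (c : ℂ) ^ 2 = 1 / 2 by rw [sq, hc]]); (try ring_nf))

/-- `S(c)` commutes with every diagonal matrix constant on the block (`d_i = d_j`). [cite: HornJohnson2013, §0.9] -/
theorem rotation'_mul_diagonal {i j : Fin N} {d : Fin N → ℂ} (hdij : d i = d j) (c : ℂ) :
    ((1 : Matrix (Fin N) (Fin N) ℂ) - Matrix.single i i 1 - Matrix.single j j 1 +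
        c • (Matrix.single i i 1 - Matrix.single i j 1) + (I * c) • (Matrix.single j i 1 + Matrix.single j j 1)) * Matrix.diagonal d =
      Matrix.diagonal d * ((1 : Matrix (Fin N) (Fin N) ℂ) - Matrix.single i i 1 - Matrix.single j j 1 +
        c • (Matrix.single i i 1 - Matrix.single i j 1) + (I * c) • (Matrix.single j i 1 + Matrix.single j j 1)) := by
  simp only [Matrix.mul_add, Matrix.add_mul, Matrix.mul_sub, Matrix.sub_mul, Matrix.smul_mul, Matrix.mul_smul, Matrix.one_mul, Matrix.mul_one,
    diagonal_mul_single', single_mul_diagonal', hdij]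


/-! ## §3 The intertwining identities -/

/-- **THE FIRST ROTATION INTERTWINES `y₁` AND `y₃`**: `R(c) · y₁ = y₃ · R(c)` for `R(c) = 1 − E_ii − E_jj + c(E_ii + E_jj + E_ji − E_ij)` (the block `c·[[1,−1],[1,1]]`, identity
elsewhere) and every scalar `c` — at `c = 1∕√2`, `R` is the rotation by `π∕4` and `Ad(R) y₁ = y₃`. [cite: Hall2015, §1.2] -/
theorem rotation_mul_frame_one {i j : Fin N} (hij : i ≠ j) (c : ℂ) :
    ((1 : Matrix (Fin N) (Fin N) ℂ) - Matrix.single i i 1 - Matrix.single j j 1 +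
        c • (Matrix.single i i 1 + Matrix.single j j 1 + Matrix.single j i 1 - Matrix.single i j 1)) * (I • (Matrix.single i i (1 : ℂ) - Matrix.single j j 1)) =
      (I • (Matrix.single i j (1 : ℂ) + Matrix.single j i 1)) * ((1 : Matrix (Fin N) (Fin N) ℂ) - Matrix.single i i 1 - Matrix.single j j 1 +
        c • (Matrix.single i i 1 + Matrix.single j j 1 + Matrix.single j i 1 - Matrix.single i j 1)) := by
  simp only [Matrix.mul_add, Matrix.add_mul, Matrix.mul_sub, Matrix.sub_mul, Matrix.smul_mul, Matrix.mul_smul, Matrix.one_mul, smul_add, smul_sub,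
    Matrix.single_mul_single_same, Matrix.single_mul_single_of_ne, hij, hij.symm, ne_eq, not_false_eq_true, mul_one, smul_zero, sub_zero, add_zero, zero_add]
  module

/-- **THE SECOND ROTATION INTERTWINES `y₁` AND `y₂`**: `S(c) · y₁ = y₂ · S(c)` for `S(c) = 1 − E_ii − E_jj + c(E_ii − E_ij) + ic(E_ji + E_jj)` (the block `[[c,−c],[ic,ic]] =
diag(1,i)·c[[1,−1],[1,1]]`). [cite: Hall2015, §1.2] -/
theorem rotation'_mul_frame_one {i j : Fin N} (hij : i ≠ j) (c : ℂ) :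
    ((1 : Matrix (Fin N) (Fin N) ℂ) - Matrix.single i i 1 - Matrix.single j j 1 +
        c • (Matrix.single i i 1 - Matrix.single i j 1) + (I * c) • (Matrix.single j i 1 + Matrix.single j j 1)) * (I • (Matrix.single i i (1 : ℂ) - Matrix.single j j 1)) =
      (Matrix.single i j (1 : ℂ) - Matrix.single j i 1) * ((1 : Matrix (Fin N) (Fin N) ℂ) - Matrix.single i i 1 - Matrix.single j j 1 +
        c • (Matrix.single i i 1 - Matrix.single i j 1) + (I * c) • (Matrix.single j i 1 + Matrix.single j j 1)) := by
  have h1 : I * (I * c) = -c := by rw [← mul_assoc, Complex.I_mul_I, neg_mul, one_mul]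
  simp only [Matrix.mul_add, Matrix.add_mul, Matrix.mul_sub, Matrix.sub_mul, Matrix.smul_mul, Matrix.mul_smul, Matrix.one_mul, smul_add, smul_sub,
    Matrix.single_mul_single_same, Matrix.single_mul_single_of_ne, hij, hij.symm, ne_eq, not_false_eq_true, mul_one, smul_zero, sub_zero, add_zero, zero_add,
    smul_smul, h1]
  module


end Literature.LinearAlgebra.Matrix.SU2Block

end
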